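import Mathlib

/-!
# SoloBlind — mirror symmetry of the streak/roll recurrences (ENGINE-L-SPEC §15(n)(5))

For the three-term recurrences `u (m-1) + u (m+1) = β m * u m` of the frozen model, the map
`x ↦ x' = -2/sc - conj x` sends the diagonal `β m = 2 + c_m(x)` to `β' m = -conj (β m)`.
We record the purely algebraic consequences used by the certified assembler for the far side
`ω < 0` of the line integral and by LEMMA P for `Re x < -1/sc`:

* `mirror_solution`: if `u` solves the recurrence with diagonal `β`, then `m ↦ (-1)^m * conj (u m)`
  solves it with diagonal `m ↦ -conj (β m)`;
* `mirror_matrix_inv`: for an invertible matrix `A` and a sign matrix `S` (`S * S = 1`),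
  `(-(S * A.map conj * S))⁻¹ = -(S * A⁻¹.map conj * S)` — so truncated Green's matrices transform
  entrywise by conjugation and the sign pattern, and invertibility is preserved.
-/

namespace Summit.AnomalousDissipation.SoloBlind.MirrorSymmetry

open Matrix

/-- `(-1)^(m-1) = (-1)^(m+1)` for integer exponents (in any field, here `ℂ`). -/
lemma neg_one_zpow_sub_one_eq (m : ℤ) : ((-1 : ℂ)) ^ (m - 1) = (-1 : ℂ) ^ (m + 1) := by
  have h : (m + 1) = (m - 1) + 2 := by ring
  rw [h, zpow_add₀ (by norm_num : (-1 : ℂ) ≠ 0)]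
  norm_num

/-- `(-1)^(m+1) = -(-1)^m`. -/
lemma neg_one_zpow_add_one (m : ℤ) : ((-1 : ℂ)) ^ (m + 1) = -((-1 : ℂ) ^ m) := by
  rw [zpow_add₀ (by norm_num : (-1 : ℂ) ≠ 0)]
  simp

/-- Mirror symmetry of solutions: conjugate and sign-alternate. -/
theorem mirror_solution (β u : ℤ → ℂ)
    (h : ∀ m : ℤ, u (m - 1) + u (m + 1) = β m * u m) :
    ∀ m : ℤ, ((-1 : ℂ) ^ (m - 1) * (starRingEnd ℂ) (u (m - 1)))
              + ((-1 : ℂ) ^ (m + 1) * (starRingEnd ℂ) (u (m + 1)))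
            = (-(starRingEnd ℂ) (β m)) * ((-1 : ℂ) ^ m * (starRingEnd ℂ) (u m)) := by
  intro m
  have hc : (starRingEnd ℂ) (u (m - 1)) + (starRingEnd ℂ) (u (m + 1))
      = (starRingEnd ℂ) (β m) * (starRingEnd ℂ) (u m) := by
    rw [← map_add, h m, map_mul]
  rw [neg_one_zpow_sub_one_eq, ← mul_add, hc, neg_one_zpow_add_one]
  ring

/-- The mirrored sequence solves the mirrored recurrence (packaged form). -/
theorem mirror_solution' (β u : ℤ → ℂ)
    (h : ∀ m : ℤ, u (m - 1) + u (m + 1) = β m * u m) :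
    let u' : ℤ → ℂ := fun m => (-1 : ℂ) ^ m * (starRingEnd ℂ) (u m)
    let β' : ℤ → ℂ := fun m => -(starRingEnd ℂ) (β m)
    ∀ m : ℤ, u' (m - 1) + u' (m + 1) = β' m * u' m := by
  intro u' β' m
  exact mirror_solution β u h m

variable {n : Type*} [Fintype n] [DecidableEq n]

/-- Entrywise conjugation commutes with the matrix inverse. -/
theorem map_conj_inv (A : Matrix n n ℂ) :
    (A⁻¹).map (starRingEnd ℂ) = (A.map (starRingEnd ℂ))⁻¹ := by
  have h1 : (A⁻¹).map (starRingEnd ℂ) = ((A⁻¹)ᴴ)ᵀ := by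
    ext i j; simp [Matrix.conjTranspose_apply, Matrix.transpose_apply]
  have h2 : A.map (starRingEnd ℂ) = (Aᴴ)ᵀ := by
    ext i j; simp [Matrix.conjTranspose_apply, Matrix.transpose_apply]
  rw [h1, h2, Matrix.conjTranspose_nonsing_inv, Matrix.transpose_nonsing_inv]

/-- Determinant bookkeeping: the mirrored conjugate matrix `S * conj A * S` has unit determinant. -/
theorem mirror_core_isUnit_det (A S : Matrix n n ℂ) (hS : S * S = 1) (hA : IsUnit A.det) :
    IsUnit (S * A.map (starRingEnd ℂ) * S).det := by
  have hSu : IsUnit S.det := by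
    have : IsUnit (S * S).det := by rw [hS]; simp
    rw [Matrix.det_mul] at this
    exact isUnit_of_mul_isUnit_left this
  have hAc : IsUnit (A.map (starRingEnd ℂ)).det := by
    have : (A.map (starRingEnd ℂ)).det = (starRingEnd ℂ) A.det := by
      rw [← RingHom.mapMatrix_apply, RingHom.map_det]
    rw [this]; exact hA.map _
  rw [Matrix.det_mul, Matrix.det_mul]
  exact (hSu.mul hAc).mul hSu

/-- Consequently the mirrored matrix `-(S * conj A * S)` is invertible whenever `A` is. -/
theorem mirror_matrix_isUnit_det (A S : Matrix n n ℂ) (hS : S * S = 1) (hA : IsUnit A.det) :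
    IsUnit (-(S * A.map (starRingEnd ℂ) * S)).det := by
  rw [Matrix.det_neg]
  exact ((isUnit_one.neg).pow _).mul (mirror_core_isUnit_det A S hS hA)

/-- Mirror symmetry of truncated Green's matrices: if `S * S = 1` then
`(-(S * conj A * S))⁻¹ = -(S * conj (A⁻¹) * S)`. -/
theorem mirror_matrix_inv (A S : Matrix n n ℂ) (hS : S * S = 1) (hA : IsUnit A.det) :
    (-(S * A.map (starRingEnd ℂ) * S))⁻¹ = -(S * (A⁻¹).map (starRingEnd ℂ) * S) := by
  have hX := mirror_core_isUnit_det A S hS hA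
  have hSinv : S⁻¹ = S := Matrix.inv_eq_left_inv hS
  have hneg : (-(S * A.map (starRingEnd ℂ) * S))⁻¹ = -((S * A.map (starRingEnd ℂ) * S)⁻¹) :=
    Matrix.inv_eq_left_inv (by rw [neg_mul_neg, Matrix.nonsing_inv_mul _ hX])
  rw [hneg, Matrix.mul_inv_rev, Matrix.mul_inv_rev, hSinv, ← map_conj_inv]
  simp [Matrix.mul_assoc]

end Summit.AnomalousDissipation.SoloBlind.MirrorSymmetry
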